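import Summits.ValiantsHypothesis.ValiantsHypothesis.Theorems.LacunarySymmetroidMatrixDescartesPivotRankOneOneThreeCircuitTriple
import Summits.ValiantsHypothesis.ValiantsHypothesis.Theorems.LacunarySymmetroidMatrixDescartesPivotRankOneOneThreeCircuitRaysA
/-!
# `MatrixDescartes` census — rank-one `(2,4)₁`, split 1/3, chamber (C): weight-free circuit rays «N02 ∨ N03 ∨ C1 ∨ C2»

HONEST FRAMING.  Object-search cell `pub-symmetroid`, seat `val-sym-mdr-p1` (generation 16); helper file `--supports` the crux item
stmt-ValiantsHypothesis-18050 (`Theses.LacunarySymmetroid.MatrixDescartes`, OPEN, on HOLD) with NO closure claim.  Conditional kernel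
theorems («condition ⇒ Z₊ ≤ 8») for chamber (C) of the 1/3 split `d₀ < e < d₁ < d₂ < d₃`; no covering theorem for (C) is claimed.
Nothing here bears on `MatrixDescartes` in its window, on `DoorA26` / `DoorA34`, registers / credences, or `VP ≠ VNP`.

WHAT IS PROVED.  Extreme rays of the Farkas cone of the eight chamber-(C) circuit normals (seat memo NULL-DIRECTION.md §4; the cone has the
same 11 extreme rays at every exponent vector of chamber (C), and every multiplier is a product of two consecutive-gap forms):
* «N02 ∨ N03 ∨ C1 ∨ C2» with powers `(d₀ + d₃ - (e + d₁)) * (e + d₂ - (d₀ + d₃))`, `(d₁ - e) * (e + d₁ - (d₀ + d₂))`, `(d₁ - e) * (e + d₂ - (d₀ + d₃))`, `(e + d₁ - (d₀ + d₂)) * (d₀ + d₃ - (e + d₁))` (`elevenNomial_chamberC_N02N03C1C2_le_eight`, matrix form `oneThree_rankOne_posRoots_le_eight_of_N02N03C1C2`);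
For each ray the product of the circuit inequalities raised to the stated powers is WEIGHT-FREE (the weights cancel by the ray identity,
certified here by `ring` on symbolic exponents after rewriting every gap as a sum of the four basic gaps `d₀+d₂−2e`, `e+d₁−d₀−d₂`,
`e+d₂−d₀−d₃`, `e+d₃−d₁−d₂`), and «product ⇒ Z₊ ≤ 8» for every choice of weights: all but the last circuit fail or apply, and if they
all fail the product forces the last one (`circuitRay_transfer_three/four`).  Companions: `…CircuitPair` (N12 ∨ C₃), `…CircuitTriple`
(N01 ∨ N02 ∨ C_J).

[folklore] Only real-number bookkeeping on top of the cited kernel circuit theorems.  No definitions, no named facts.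
-/

-- `Summit.ValiantsHypothesis.ValiantsHypothesis.…` repeats a component by the D-0017 layout
-- (single-conjunct summit), which the `dupNamespace` linter flags; the name is mandated.
set_option linter.dupNamespace false

namespace Summit.ValiantsHypothesis.ValiantsHypothesis.Theorems.LacunarySymmetroidMatrixDescartes.Pivot.TwoDirections.BlockLaw

open Polynomial Matrix Finset
open scoped BigOperators

/-- **Circuit ray «N02 ∨ N03 ∨ C1 ∨ C2» of chamber (C), real form.**  If the weight-free product of the (N02), (N03), (C1), (C2) circuit inequalities raised to the
chamber-positive powers `(d₀ + d₃ - (e + d₁)) * (e + d₂ - (d₀ + d₃))`, `(d₁ - e) * (e + d₁ - (d₀ + d₂))`, `(d₁ - e) * (e + d₂ - (d₀ + d₃))`, `(e + d₁ - (d₀ + d₂)) * (d₀ + d₃ - (e + d₁))` holds, then one of the circuits applies and `Z₊ ≤ 8`. [this file] -/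
theorem elevenNomial_chamberC_N02N03C1C2_le_eight (e d₀ d₁ d₂ d₃ : ℕ) (h0e : d₀ < e) (he1 : e < d₁) (h12 : d₁ < d₂) (h23 : d₂ < d₃)
    (hC1 : d₀ + d₁ < 2 * e) (hC2 : 2 * e < d₀ + d₂) (hC3 : d₀ + d₂ < e + d₁) (hC4 : e + d₁ < d₀ + d₃) (hC5 : d₀ + d₃ < e + d₂) (hC6 : d₁ + d₂ < e + d₃)
    (dJ m₀ m₁ m₂ m₃ w₀ w₁ w₂ w₃ D01 D02 D03 D12 D13 D23 : ℝ) (hw₀ : 0 < w₀) (hw₁ : 0 < w₁) (hw₂ : 0 < w₂) (hw₃ : 0 < w₃) (hm₁ : m₁ < 0) (hm₂ : m₂ < 0) (hdJ : dJ < 0) (hD02 : 0 < D02) (hD03 : 0 < D03) (hD12 : 0 < D12)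
    (hcomb : ((D02 * (((d₂ : ℝ) - e) * ((e : ℝ) - d₀) * ((e : ℝ) + d₃ - d₀ - d₂) * ((d₂ : ℝ) - d₁) * ((d₃ : ℝ) - d₂) * ((d₁ : ℝ) - d₀) * ((d₁ : ℝ) + d₃ - d₀ - d₂) * ((d₃ : ℝ) - d₀))) ^ (d₀ + d₂ - 2 * e + (e + d₁ - (d₀ + d₂))) * ((((e + d₁ - (d₀ + d₂) : ℕ) : ℝ)) ^ (e + d₁ - (d₀ + d₂)) * (((d₀ + d₂ - 2 * e : ℕ) : ℝ)) ^ (d₀ + d₂ - 2 * e))) ^ ((d₀ + d₃ - (e + d₁)) * (e + d₂ - (d₀ + d₃))) * ((D03 * (((d₀ : ℝ) + d₃ - 2 * e) * ((d₃ : ℝ) - e) * ((e : ℝ) - d₀) * ((d₃ : ℝ) - d₁) * ((d₃ : ℝ) - d₂) * ((d₁ : ℝ) + d₂ - d₀ - d₃) * ((d₁ : ℝ) - d₀) * ((d₂ : ℝ) - d₀))) ^ (d₀ + d₃ - (e + d₁) + (e + d₂ - (d₀ + d₃))) * ((((e + d₂ - (d₀ + d₃) : ℕ) : ℝ)) ^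 (e + d₂ - (d₀ + d₃)) * (((d₀ + d₃ - (e + d₁) : ℕ) : ℝ)) ^ (d₀ + d₃ - (e + d₁)))) ^ ((d₁ - e) * (e + d₁ - (d₀ + d₂))) * (((-m₁) * (((d₁ : ℝ) - e) * ((d₁ : ℝ) - d₀) * ((d₂ : ℝ) - d₁) * ((d₃ : ℝ) - d₁) * ((e : ℝ) - d₀) * ((d₂ : ℝ) - e) * ((d₃ : ℝ) - e) * ((d₂ : ℝ) + d₃ - e - d₁))) ^ ((e + d₁) - d₀ - d₂ + ((d₀ + d₃) - e - d₁)) * (((((d₀ + d₃) - e - d₁ : ℕ) : ℝ)) ^ ((d₀ + d₃) - e - d₁) * ((((e + d₁) - d₀ - d₂ : ℕ) : ℝ)) ^ ((e + d₁) - d₀ - d₂))) ^ ((d₁ - e) * (e + d₂ - (d₀ + d₃))) * (((-m₂) * (((d₂ : ℝ) - e) * ((d₂ : ℝ) - d₀) * ((d₂ : ℝ) - d₁) * ((d₃ : ℝ) - d₂) * ((e : ℝ) + d₂ - d₀ - d₁) * ((e : ℝ) - d₀) * ((d₁ : ℝ) + d₃ - e - d₂) * ((d₃ : ℝ) - e)))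 ^ ((e + d₂) - d₀ - d₃ + (d₁ - e)) * ((((d₁ - e : ℕ) : ℝ)) ^ (d₁ - e) * ((((e + d₂) - d₀ - d₃ : ℕ) : ℝ)) ^ ((e + d₂) - d₀ - d₃))) ^ ((e + d₁ - (d₀ + d₂)) * (d₀ + d₃ - (e + d₁)))
      < ((((d₀ + d₂ - 2 * e + (e + d₁ - (d₀ + d₂)) : ℕ) : ℝ)) ^ (d₀ + d₂ - 2 * e + (e + d₁ - (d₀ + d₂))) * (((-dJ) * (((e : ℝ) - d₀) * ((d₂ : ℝ) - e) * ((d₃ : ℝ) - e) * ((2 : ℝ) * e - d₀ - d₁) * ((d₀ : ℝ) + d₃ - 2 * e) * ((d₁ : ℝ) + d₂ - 2 * e) * ((d₁ : ℝ) + d₃ - 2 * e) * ((d₂ : ℝ) + d₃ - 2 * e))) ^ (e + d₁ - (d₀ + d₂)) * ((-m₁) * (((d₁ : ℝ) - d₀) * ((d₂ : ℝ) - d₁) * ((d₃ : ℝ) - d₁) * ((e : ℝ) - d₀) * ((d₀ : ℝ) + d₃ - e - d₁) * ((d₂ : ℝ) - e) * ((d₃ : ℝ) - e) * ((d₂ :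 ℝ) + d₃ - e - d₁))) ^ (d₀ + d₂ - 2 * e))) ^ ((d₀ + d₃ - (e + d₁)) * (e + d₂ - (d₀ + d₃))) * ((((d₀ + d₃ - (e + d₁) + (e + d₂ - (d₀ + d₃)) : ℕ) : ℝ)) ^ (d₀ + d₃ - (e + d₁) + (e + d₂ - (d₀ + d₃))) * (((-m₁) * (((d₁ : ℝ) - e) * ((d₁ : ℝ) - d₀) * ((d₃ : ℝ) - d₁) * ((e : ℝ) - d₀) * ((e : ℝ) + d₁ - d₀ - d₂) * ((d₂ : ℝ) - e) * ((d₃ : ℝ) - e) * ((d₂ : ℝ) + d₃ - e - d₁))) ^ (e + d₂ - (d₀ + d₃)) * ((-m₂) * (((d₂ : ℝ) - e) * ((d₂ : ℝ) - d₀) * ((d₃ : ℝ) - d₂) * ((e : ℝ) + d₂ - d₀ - d₁) * ((e : ℝ) - d₀) * ((d₁ : ℝ) - e) * ((d₁ : ℝ) + d₃ - e - d₂) * ((d₃ : ℝ) - e))) ^ (d₀ + d₃ - (e + d₁)))) ^ ((d₁ - e) * (e + d₁ - (d₀ + d₂))) * (((((e + d₁) - d₀ - d₂ + ((d₀ + d₃)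 - e - d₁) : ℕ) : ℝ)) ^ ((e + d₁) - d₀ - d₂ + ((d₀ + d₃) - e - d₁)) * ((D02 * (((d₀ : ℝ) + d₂ - 2 * e) * ((d₂ : ℝ) - e) * ((e : ℝ) - d₀) * ((e : ℝ) + d₃ - d₀ - d₂) * ((d₂ : ℝ) - d₁) * ((d₁ : ℝ) - d₀) * ((d₁ : ℝ) + d₃ - d₀ - d₂) * ((d₃ : ℝ) - d₀))) ^ ((d₀ + d₃) - e - d₁) * (D03 * (((d₀ : ℝ) + d₃ - 2 * e) * ((d₃ : ℝ) - e) * ((e : ℝ) + d₂ - d₀ - d₃) * ((e : ℝ) - d₀) * ((d₃ : ℝ) - d₁) * ((d₁ : ℝ) + d₂ - d₀ - d₃) * ((d₁ : ℝ) - d₀) * ((d₂ : ℝ) - d₀))) ^ ((e + d₁) - d₀ - d₂))) ^ ((d₁ - e) * (e + d₂ - (d₀ + d₃))) * (((((e + d₂) - d₀ - d₃ + (d₁ - e) : ℕ) : ℝ)) ^ ((e + d₂) - d₀ - d₃ + (d₁ - e)) * ((D03 * (((d₀ : ℝ) + d₃ - 2 * e) * ((d₃ : ℝ) - e) * ((d₀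 : ℝ) + d₃ - e - d₁) * ((e : ℝ) - d₀) * ((d₃ : ℝ) - d₁) * ((d₃ : ℝ) - d₂) * ((d₁ : ℝ) - d₀) * ((d₂ : ℝ) - d₀))) ^ (d₁ - e) * (D12 * (((d₁ : ℝ) + d₂ - 2 * e) * ((d₁ : ℝ) + d₂ - e - d₀) * ((d₂ : ℝ) - e) * ((e : ℝ) + d₃ - d₁ - d₂) * ((d₂ : ℝ) - d₀) * ((d₁ : ℝ) - d₀) * ((d₃ : ℝ) - d₂) * ((d₃ : ℝ) - d₁))) ^ ((e + d₂) - d₀ - d₃))) ^ ((e + d₁ - (d₀ + d₂)) * (d₀ + d₃ - (e + d₁)))) :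
    ((∑ i : Fin 11, Polynomial.C ((![dJ, w₀ * m₀, w₁ * m₁, w₂ * m₂, w₃ * m₃, w₀ * w₁ * D01, w₀ * w₂ * D02, w₀ * w₃ * D03, w₁ * w₂ * D12, w₁ * w₃ * D13, w₂ * w₃ * D23] : Fin 11 → ℝ) i) * X ^ ((![2 * e, e + d₀, e + d₁, e + d₂, e + d₃, d₀ + d₁, d₀ + d₂, d₀ + d₃, d₁ + d₂, d₁ + d₃, d₂ + d₃] : Fin 11 → ℕ) i)).roots.toFinset.filter (fun t => 0 < t)).card ≤ 8 := by
  classical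
  rcases lt_or_ge ((w₀ * w₂ * D02 * (((d₂ : ℝ) - e) * ((e : ℝ) - d₀) * ((e : ℝ) + d₃ - d₀ - d₂) * ((d₂ : ℝ) - d₁) * ((d₃ : ℝ) - d₂) * ((d₁ : ℝ) - d₀) * ((d₁ : ℝ) + d₃ - d₀ - d₂) * ((d₃ : ℝ) - d₀))) ^ (d₀ + d₂ - 2 * e + (e + d₁ - (d₀ + d₂))) * ((((e + d₁ - (d₀ + d₂) : ℕ) : ℝ)) ^ (e + d₁ - (d₀ + d₂)) * (((d₀ + d₂ - 2 * e : ℕ) : ℝ)) ^ (d₀ + d₂ - 2 * e))) ((((d₀ + d₂ - 2 * e + (e + d₁ - (d₀ + d₂)) : ℕ) : ℝ)) ^ (d₀ + d₂ - 2 * e + (e + d₁ - (d₀ + d₂))) * (((-dJ) * (((e : ℝ) - d₀) * ((d₂ : ℝ) - e) * ((d₃ : ℝ) - e) * ((2 : ℝ) * e - d₀ - d₁) * ((d₀ : ℝ) + d₃ - 2 * e) * ((d₁ : ℝ) + d₂ - 2 * e) * ((d₁ : ℝ) + d₃ - 2 * e) * ((d₂ : ℝ) + d₃ - 2 * e)))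 ^ (e + d₁ - (d₀ + d₂)) * (w₁ * (-m₁) * (((d₁ : ℝ) - d₀) * ((d₂ : ℝ) - d₁) * ((d₃ : ℝ) - d₁) * ((e : ℝ) - d₀) * ((d₀ : ℝ) + d₃ - e - d₁) * ((d₂ : ℝ) - e) * ((d₃ : ℝ) - e) * ((d₂ : ℝ) + d₃ - e - d₁))) ^ (d₀ + d₂ - 2 * e))) with h1 | h1
  · exact elevenNomial_chamberC_N02_le_eight e d₀ d₁ d₂ d₃ h0e he1 h12 h23 hC1 hC2 hC3 hC4 hC5 hC6 dJ m₀ m₁ m₂ m₃ w₀ w₁ w₂ w₃ D01 D02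
      D03 D12 D13 D23 hw₁ hdJ hm₁ h1
  rcases lt_or_ge ((w₀ * w₃ * D03 * (((d₀ : ℝ) + d₃ - 2 * e) * ((d₃ : ℝ) - e) * ((e : ℝ) - d₀) * ((d₃ : ℝ) - d₁) * ((d₃ : ℝ) - d₂) * ((d₁ : ℝ) + d₂ - d₀ - d₃) * ((d₁ : ℝ) - d₀) * ((d₂ : ℝ) - d₀))) ^ (d₀ + d₃ - (e + d₁) + (e + d₂ - (d₀ + d₃))) * ((((e + d₂ - (d₀ + d₃) : ℕ) : ℝ)) ^ (e + d₂ - (d₀ + d₃)) * (((d₀ + d₃ - (e + d₁) : ℕ) : ℝ)) ^ (d₀ + d₃ - (e + d₁)))) ((((d₀ + d₃ - (e + d₁) + (e + d₂ - (d₀ + d₃)) : ℕ) : ℝ)) ^ (d₀ + d₃ - (e + d₁) + (e + d₂ - (d₀ + d₃))) * ((w₁ * (-m₁) * (((d₁ : ℝ) - e) * ((d₁ : ℝ) - d₀) * ((d₃ : ℝ) - d₁) * ((e : ℝ) - d₀) * ((e : ℝ) + d₁ - d₀ - d₂) * ((d₂ : ℝ) - e) * ((d₃ : ℝ) - e) *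 ((d₂ : ℝ) + d₃ - e - d₁))) ^ (e + d₂ - (d₀ + d₃)) * (w₂ * (-m₂) * (((d₂ : ℝ) - e) * ((d₂ : ℝ) - d₀) * ((d₃ : ℝ) - d₂) * ((e : ℝ) + d₂ - d₀ - d₁) * ((e : ℝ) - d₀) * ((d₁ : ℝ) - e) * ((d₁ : ℝ) + d₃ - e - d₂) * ((d₃ : ℝ) - e))) ^ (d₀ + d₃ - (e + d₁)))) with h2 | h2
  · exact elevenNomial_chamberC_N03_le_eight e d₀ d₁ d₂ d₃ h0e he1 h12 h23 hC1 hC2 hC3 hC4 hC5 hC6 dJ m₀ m₁ m₂ m₃ w₀ w₁ w₂ w₃ D01 D02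
      D03 D12 D13 D23 hw₁ hw₂ hm₁ hm₂ h2
  rcases lt_or_ge ((w₁ * (-m₁) * (((d₁ : ℝ) - e) * ((d₁ : ℝ) - d₀) * ((d₂ : ℝ) - d₁) * ((d₃ : ℝ) - d₁) * ((e : ℝ) - d₀) * ((d₂ : ℝ) - e) * ((d₃ : ℝ) - e) * ((d₂ : ℝ) + d₃ - e - d₁))) ^ ((e + d₁) - d₀ - d₂ + ((d₀ + d₃) - e - d₁)) * (((((d₀ + d₃) - e - d₁ : ℕ) : ℝ)) ^ ((d₀ + d₃) - e - d₁) * ((((e + d₁) - d₀ - d₂ : ℕ) : ℝ)) ^ ((e + d₁) - d₀ - d₂))) (((((e + d₁) - d₀ - d₂ + ((d₀ + d₃) - e - d₁) : ℕ) : ℝ)) ^ ((e + d₁) - d₀ - d₂ + ((d₀ + d₃) - e - d₁)) * ((w₀ * w₂ * D02 * (((d₀ : ℝ) + d₂ - 2 * e) * ((d₂ : ℝ) - e) * ((e : ℝ) - d₀) * ((e : ℝ) + d₃ - d₀ - d₂) * ((d₂ : ℝ) - d₁) * ((d₁ : ℝ) - d₀) * ((d₁ : ℝ) + d₃ - d₀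 - d₂) * ((d₃ : ℝ) - d₀))) ^ ((d₀ + d₃) - e - d₁) * (w₀ * w₃ * D03 * (((d₀ : ℝ) + d₃ - 2 * e) * ((d₃ : ℝ) - e) * ((e : ℝ) + d₂ - d₀ - d₃) * ((e : ℝ) - d₀) * ((d₃ : ℝ) - d₁) * ((d₁ : ℝ) + d₂ - d₀ - d₃) * ((d₁ : ℝ) - d₀) * ((d₂ : ℝ) - d₀))) ^ ((e + d₁) - d₀ - d₂))) with h3 | h3
  · exact elevenNomial_chamberC_C1_le_eight e d₀ d₁ d₂ d₃ h0e he1 h12 h23 hC2 hC3 hC4 hC5 dJ m₀ m₁ m₂ m₃ w₀ w₁ w₂ w₃ D01 D02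
      D03 D12 D13 D23 hw₀ hw₂ hw₃ hD02 hD03 h3
  have h0e' : (d₀ : ℝ) < e := by exact_mod_cast h0e
  have he1' : (e : ℝ) < d₁ := by exact_mod_cast he1
  have h12' : (d₁ : ℝ) < d₂ := by exact_mod_cast h12
  have h23' : (d₂ : ℝ) < d₃ := by exact_mod_cast h23
  have hC1' : (d₀ : ℝ) + d₁ < 2 * e := by exact_mod_cast hC1
  have hC2' : 2 * (e : ℝ) < d₀ + d₂ := by exact_mod_cast hC2
  have hC3' : (d₀ : ℝ) + d₂ < e + d₁ := by exact_mod_cast hC3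
  have hC4' : (e : ℝ) + d₁ < d₀ + d₃ := by exact_mod_cast hC4
  have hC5' : (d₀ : ℝ) + d₃ < e + d₂ := by exact_mod_cast hC5
  have hC6' : (d₁ : ℝ) + d₂ < e + d₃ := by exact_mod_cast hC6
  have hPBN02 : 0 < (((d₂ : ℝ) - e) * ((e : ℝ) - d₀) * ((e : ℝ) + d₃ - d₀ - d₂) * ((d₂ : ℝ) - d₁) * ((d₃ : ℝ) - d₂) * ((d₁ : ℝ) - d₀) * ((d₁ : ℝ) + d₃ - d₀ - d₂) * ((d₃ : ℝ) - d₀)) := by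
    have f1 : 0 < ((d₂ : ℝ) - e) := by linarith only [h0e', he1', h12', h23', hC1', hC2', hC3', hC4', hC5', hC6']
    have f2 : 0 < ((e : ℝ) - d₀) := by linarith only [h0e', he1', h12', h23', hC1', hC2', hC3', hC4', hC5', hC6']
    have f3 : 0 < ((e : ℝ) + d₃ - d₀ - d₂) := by linarith only [h0e', he1', h12', h23', hC1', hC2', hC3', hC4', hC5', hC6']
    have f4 : 0 < ((d₂ : ℝ) - d₁) := by linarith only [h0e', he1', h12', h23', hC1', hC2', hC3', hC4', hC5', hC6']
    have f5 : 0 < ((d₃ : ℝ) - d₂) := by linarith only [h0e', he1', h12', h23', hC1', hC2', hC3', hC4', hC5', hC6']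
    have f6 : 0 < ((d₁ : ℝ) - d₀) := by linarith only [h0e', he1', h12', h23', hC1', hC2', hC3', hC4', hC5', hC6']
    have f7 : 0 < ((d₁ : ℝ) + d₃ - d₀ - d₂) := by linarith only [h0e', he1', h12', h23', hC1', hC2', hC3', hC4', hC5', hC6']
    have f8 : 0 < ((d₃ : ℝ) - d₀) := by linarith only [h0e', he1', h12', h23', hC1', hC2', hC3', hC4', hC5', hC6']
    exact mul_pos (mul_pos (mul_pos (mul_pos (mul_pos (mul_pos (mul_pos f1 f2) f3) f4) f5) f6) f7) f8
  have hPAN02 : 0 < (((e : ℝ) - d₀) * ((d₂ : ℝ) - e) * ((d₃ : ℝ) - e) * ((2 : ℝ) * e - d₀ - d₁) * ((d₀ : ℝ) + d₃ - 2 * e) * ((d₁ : ℝ) + d₂ - 2 * e) * ((d₁ : ℝ) + d₃ - 2 * e) * ((d₂ : ℝ) + d₃ - 2 * e)) := by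
    have f1 : 0 < ((e : ℝ) - d₀) := by linarith only [h0e', he1', h12', h23', hC1', hC2', hC3', hC4', hC5', hC6']
    have f2 : 0 < ((d₂ : ℝ) - e) := by linarith only [h0e', he1', h12', h23', hC1', hC2', hC3', hC4', hC5', hC6']
    have f3 : 0 < ((d₃ : ℝ) - e) := by linarith only [h0e', he1', h12', h23', hC1', hC2', hC3', hC4', hC5', hC6']
    have f4 : 0 < ((2 : ℝ) * e - d₀ - d₁) := by linarith only [h0e', he1', h12', h23', hC1', hC2', hC3', hC4', hC5', hC6']
    have f5 : 0 < ((d₀ : ℝ) + d₃ - 2 * e) := by linarith only [h0e', he1', h12', h23', hC1', hC2', hC3', hC4', hC5', hC6']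
    have f6 : 0 < ((d₁ : ℝ) + d₂ - 2 * e) := by linarith only [h0e', he1', h12', h23', hC1', hC2', hC3', hC4', hC5', hC6']
    have f7 : 0 < ((d₁ : ℝ) + d₃ - 2 * e) := by linarith only [h0e', he1', h12', h23', hC1', hC2', hC3', hC4', hC5', hC6']
    have f8 : 0 < ((d₂ : ℝ) + d₃ - 2 * e) := by linarith only [h0e', he1', h12', h23', hC1', hC2', hC3', hC4', hC5', hC6']
    exact mul_pos (mul_pos (mul_pos (mul_pos (mul_pos (mul_pos (mul_pos f1 f2) f3) f4) f5) f6) f7) f8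
  have hPCN02 : 0 < (((d₁ : ℝ) - d₀) * ((d₂ : ℝ) - d₁) * ((d₃ : ℝ) - d₁) * ((e : ℝ) - d₀) * ((d₀ : ℝ) + d₃ - e - d₁) * ((d₂ : ℝ) - e) * ((d₃ : ℝ) - e) * ((d₂ : ℝ) + d₃ - e - d₁)) := by
    have f1 : 0 < ((d₁ : ℝ) - d₀) := by linarith only [h0e', he1', h12', h23', hC1', hC2', hC3', hC4', hC5', hC6']
    have f2 : 0 < ((d₂ : ℝ) - d₁) := by linarith only [h0e', he1', h12', h23', hC1', hC2', hC3', hC4', hC5', hC6']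
    have f3 : 0 < ((d₃ : ℝ) - d₁) := by linarith only [h0e', he1', h12', h23', hC1', hC2', hC3', hC4', hC5', hC6']
    have f4 : 0 < ((e : ℝ) - d₀) := by linarith only [h0e', he1', h12', h23', hC1', hC2', hC3', hC4', hC5', hC6']
    have f5 : 0 < ((d₀ : ℝ) + d₃ - e - d₁) := by linarith only [h0e', he1', h12', h23', hC1', hC2', hC3', hC4', hC5', hC6']
    have f6 : 0 < ((d₂ : ℝ) - e) := by linarith only [h0e', he1', h12', h23', hC1', hC2', hC3', hC4', hC5', hC6']
    have f7 : 0 < ((d₃ : ℝ) - e) := by linarith only [h0e', he1', h12', h23', hC1', hC2', hC3', hC4', hC5', hC6']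
    have f8 : 0 < ((d₂ : ℝ) + d₃ - e - d₁) := by linarith only [h0e', he1', h12', h23', hC1', hC2', hC3', hC4', hC5', hC6']
    exact mul_pos (mul_pos (mul_pos (mul_pos (mul_pos (mul_pos (mul_pos f1 f2) f3) f4) f5) f6) f7) f8
  have hPBN03 : 0 < (((d₀ : ℝ) + d₃ - 2 * e) * ((d₃ : ℝ) - e) * ((e : ℝ) - d₀) * ((d₃ : ℝ) - d₁) * ((d₃ : ℝ) - d₂) * ((d₁ : ℝ) + d₂ - d₀ - d₃) * ((d₁ : ℝ) - d₀) * ((d₂ : ℝ) - d₀)) := by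
    have f1 : 0 < ((d₀ : ℝ) + d₃ - 2 * e) := by linarith only [h0e', he1', h12', h23', hC1', hC2', hC3', hC4', hC5', hC6']
    have f2 : 0 < ((d₃ : ℝ) - e) := by linarith only [h0e', he1', h12', h23', hC1', hC2', hC3', hC4', hC5', hC6']
    have f3 : 0 < ((e : ℝ) - d₀) := by linarith only [h0e', he1', h12', h23', hC1', hC2', hC3', hC4', hC5', hC6']
    have f4 : 0 < ((d₃ : ℝ) - d₁) := by linarith only [h0e', he1', h12', h23', hC1', hC2', hC3', hC4', hC5', hC6']
    have f5 : 0 < ((d₃ : ℝ) - d₂) := by linarith only [h0e', he1', h12', h23', hC1', hC2', hC3', hC4', hC5', hC6']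
    have f6 : 0 < ((d₁ : ℝ) + d₂ - d₀ - d₃) := by linarith only [h0e', he1', h12', h23', hC1', hC2', hC3', hC4', hC5', hC6']
    have f7 : 0 < ((d₁ : ℝ) - d₀) := by linarith only [h0e', he1', h12', h23', hC1', hC2', hC3', hC4', hC5', hC6']
    have f8 : 0 < ((d₂ : ℝ) - d₀) := by linarith only [h0e', he1', h12', h23', hC1', hC2', hC3', hC4', hC5', hC6']
    exact mul_pos (mul_pos (mul_pos (mul_pos (mul_pos (mul_pos (mul_pos f1 f2) f3) f4) f5) f6) f7) f8
  have hPAN03 : 0 < (((d₁ : ℝ) - e) * ((d₁ : ℝ) - d₀) * ((d₃ : ℝ) - d₁) * ((e : ℝ) - d₀) * ((e : ℝ) + d₁ - d₀ - d₂) * ((d₂ : ℝ) - e) * ((d₃ : ℝ) - e) * ((d₂ : ℝ) + d₃ - e - d₁)) := by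
    have f1 : 0 < ((d₁ : ℝ) - e) := by linarith only [h0e', he1', h12', h23', hC1', hC2', hC3', hC4', hC5', hC6']
    have f2 : 0 < ((d₁ : ℝ) - d₀) := by linarith only [h0e', he1', h12', h23', hC1', hC2', hC3', hC4', hC5', hC6']
    have f3 : 0 < ((d₃ : ℝ) - d₁) := by linarith only [h0e', he1', h12', h23', hC1', hC2', hC3', hC4', hC5', hC6']
    have f4 : 0 < ((e : ℝ) - d₀) := by linarith only [h0e', he1', h12', h23', hC1', hC2', hC3', hC4', hC5', hC6']
    have f5 : 0 < ((e : ℝ) + d₁ - d₀ - d₂) := by linarith only [h0e', he1', h12', h23', hC1', hC2', hC3', hC4', hC5', hC6']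
    have f6 : 0 < ((d₂ : ℝ) - e) := by linarith only [h0e', he1', h12', h23', hC1', hC2', hC3', hC4', hC5', hC6']
    have f7 : 0 < ((d₃ : ℝ) - e) := by linarith only [h0e', he1', h12', h23', hC1', hC2', hC3', hC4', hC5', hC6']
    have f8 : 0 < ((d₂ : ℝ) + d₃ - e - d₁) := by linarith only [h0e', he1', h12', h23', hC1', hC2', hC3', hC4', hC5', hC6']
    exact mul_pos (mul_pos (mul_pos (mul_pos (mul_pos (mul_pos (mul_pos f1 f2) f3) f4) f5) f6) f7) f8
  have hPCN03 : 0 < (((d₂ : ℝ) - e) * ((d₂ : ℝ) - d₀) * ((d₃ : ℝ) - d₂) * ((e : ℝ) + d₂ - d₀ - d₁) * ((e : ℝ) - d₀) * ((d₁ : ℝ) - e) * ((d₁ : ℝ) + d₃ - e - d₂) * ((d₃ : ℝ) - e)) := by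
    have f1 : 0 < ((d₂ : ℝ) - e) := by linarith only [h0e', he1', h12', h23', hC1', hC2', hC3', hC4', hC5', hC6']
    have f2 : 0 < ((d₂ : ℝ) - d₀) := by linarith only [h0e', he1', h12', h23', hC1', hC2', hC3', hC4', hC5', hC6']
    have f3 : 0 < ((d₃ : ℝ) - d₂) := by linarith only [h0e', he1', h12', h23', hC1', hC2', hC3', hC4', hC5', hC6']
    have f4 : 0 < ((e : ℝ) + d₂ - d₀ - d₁) := by linarith only [h0e', he1', h12', h23', hC1', hC2', hC3', hC4', hC5', hC6']
    have f5 : 0 < ((e : ℝ) - d₀) := by linarith only [h0e', he1', h12', h23', hC1', hC2', hC3', hC4', hC5', hC6']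
    have f6 : 0 < ((d₁ : ℝ) - e) := by linarith only [h0e', he1', h12', h23', hC1', hC2', hC3', hC4', hC5', hC6']
    have f7 : 0 < ((d₁ : ℝ) + d₃ - e - d₂) := by linarith only [h0e', he1', h12', h23', hC1', hC2', hC3', hC4', hC5', hC6']
    have f8 : 0 < ((d₃ : ℝ) - e) := by linarith only [h0e', he1', h12', h23', hC1', hC2', hC3', hC4', hC5', hC6']
    exact mul_pos (mul_pos (mul_pos (mul_pos (mul_pos (mul_pos (mul_pos f1 f2) f3) f4) f5) f6) f7) f8
  have hPBC1 : 0 < (((d₁ : ℝ) - e) * ((d₁ : ℝ) - d₀) * ((d₂ : ℝ) - d₁) * ((d₃ : ℝ) - d₁) * ((e : ℝ) - d₀) * ((d₂ : ℝ) - e) * ((d₃ : ℝ) - e) * ((d₂ : ℝ) + d₃ - e - d₁)) := by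
    have f1 : 0 < ((d₁ : ℝ) - e) := by linarith only [h0e', he1', h12', h23', hC1', hC2', hC3', hC4', hC5', hC6']
    have f2 : 0 < ((d₁ : ℝ) - d₀) := by linarith only [h0e', he1', h12', h23', hC1', hC2', hC3', hC4', hC5', hC6']
    have f3 : 0 < ((d₂ : ℝ) - d₁) := by linarith only [h0e', he1', h12', h23', hC1', hC2', hC3', hC4', hC5', hC6']
    have f4 : 0 < ((d₃ : ℝ) - d₁) := by linarith only [h0e', he1', h12', h23', hC1', hC2', hC3', hC4', hC5', hC6']
    have f5 : 0 < ((e : ℝ) - d₀) := by linarith only [h0e', he1', h12', h23', hC1', hC2', hC3', hC4', hC5', hC6']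
    have f6 : 0 < ((d₂ : ℝ) - e) := by linarith only [h0e', he1', h12', h23', hC1', hC2', hC3', hC4', hC5', hC6']
    have f7 : 0 < ((d₃ : ℝ) - e) := by linarith only [h0e', he1', h12', h23', hC1', hC2', hC3', hC4', hC5', hC6']
    have f8 : 0 < ((d₂ : ℝ) + d₃ - e - d₁) := by linarith only [h0e', he1', h12', h23', hC1', hC2', hC3', hC4', hC5', hC6']
    exact mul_pos (mul_pos (mul_pos (mul_pos (mul_pos (mul_pos (mul_pos f1 f2) f3) f4) f5) f6) f7) f8
  have hPAC1 : 0 < (((d₀ : ℝ) + d₂ - 2 * e) * ((d₂ : ℝ) - e) * ((e : ℝ) - d₀) * ((e : ℝ) + d₃ - d₀ - d₂) * ((d₂ : ℝ) - d₁) * ((d₁ : ℝ) - d₀) * ((d₁ : ℝ) + d₃ - d₀ - d₂) * ((d₃ : ℝ) - d₀)) := by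
    have f1 : 0 < ((d₀ : ℝ) + d₂ - 2 * e) := by linarith only [h0e', he1', h12', h23', hC1', hC2', hC3', hC4', hC5', hC6']
    have f2 : 0 < ((d₂ : ℝ) - e) := by linarith only [h0e', he1', h12', h23', hC1', hC2', hC3', hC4', hC5', hC6']
    have f3 : 0 < ((e : ℝ) - d₀) := by linarith only [h0e', he1', h12', h23', hC1', hC2', hC3', hC4', hC5', hC6']
    have f4 : 0 < ((e : ℝ) + d₃ - d₀ - d₂) := by linarith only [h0e', he1', h12', h23', hC1', hC2', hC3', hC4', hC5', hC6']
    have f5 : 0 < ((d₂ : ℝ) - d₁) := by linarith only [h0e', he1', h12', h23', hC1', hC2', hC3', hC4', hC5', hC6']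
    have f6 : 0 < ((d₁ : ℝ) - d₀) := by linarith only [h0e', he1', h12', h23', hC1', hC2', hC3', hC4', hC5', hC6']
    have f7 : 0 < ((d₁ : ℝ) + d₃ - d₀ - d₂) := by linarith only [h0e', he1', h12', h23', hC1', hC2', hC3', hC4', hC5', hC6']
    have f8 : 0 < ((d₃ : ℝ) - d₀) := by linarith only [h0e', he1', h12', h23', hC1', hC2', hC3', hC4', hC5', hC6']
    exact mul_pos (mul_pos (mul_pos (mul_pos (mul_pos (mul_pos (mul_pos f1 f2) f3) f4) f5) f6) f7) f8
  have hPCC1 : 0 < (((d₀ : ℝ) + d₃ - 2 * e) * ((d₃ : ℝ) - e) * ((e : ℝ) + d₂ - d₀ - d₃) * ((e : ℝ) - d₀) * ((d₃ : ℝ) - d₁) * ((d₁ : ℝ) + d₂ - d₀ - d₃) * ((d₁ : ℝ) - d₀) * ((d₂ : ℝ) - d₀)) := by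
    have f1 : 0 < ((d₀ : ℝ) + d₃ - 2 * e) := by linarith only [h0e', he1', h12', h23', hC1', hC2', hC3', hC4', hC5', hC6']
    have f2 : 0 < ((d₃ : ℝ) - e) := by linarith only [h0e', he1', h12', h23', hC1', hC2', hC3', hC4', hC5', hC6']
    have f3 : 0 < ((e : ℝ) + d₂ - d₀ - d₃) := by linarith only [h0e', he1', h12', h23', hC1', hC2', hC3', hC4', hC5', hC6']
    have f4 : 0 < ((e : ℝ) - d₀) := by linarith only [h0e', he1', h12', h23', hC1', hC2', hC3', hC4', hC5', hC6']
    have f5 : 0 < ((d₃ : ℝ) - d₁) := by linarith only [h0e', he1', h12', h23', hC1', hC2', hC3', hC4', hC5', hC6']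
    have f6 : 0 < ((d₁ : ℝ) + d₂ - d₀ - d₃) := by linarith only [h0e', he1', h12', h23', hC1', hC2', hC3', hC4', hC5', hC6']
    have f7 : 0 < ((d₁ : ℝ) - d₀) := by linarith only [h0e', he1', h12', h23', hC1', hC2', hC3', hC4', hC5', hC6']
    have f8 : 0 < ((d₂ : ℝ) - d₀) := by linarith only [h0e', he1', h12', h23', hC1', hC2', hC3', hC4', hC5', hC6']
    exact mul_pos (mul_pos (mul_pos (mul_pos (mul_pos (mul_pos (mul_pos f1 f2) f3) f4) f5) f6) f7) f8
  have hPAC2 : 0 < (((d₀ : ℝ) + d₃ - 2 * e) * ((d₃ : ℝ) - e) * ((d₀ : ℝ) + d₃ - e - d₁) * ((e : ℝ) - d₀) * ((d₃ : ℝ) - d₁) * ((d₃ : ℝ) - d₂) * ((d₁ : ℝ) - d₀) * ((d₂ : ℝ) - d₀)) := by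
    have f1 : 0 < ((d₀ : ℝ) + d₃ - 2 * e) := by linarith only [h0e', he1', h12', h23', hC1', hC2', hC3', hC4', hC5', hC6']
    have f2 : 0 < ((d₃ : ℝ) - e) := by linarith only [h0e', he1', h12', h23', hC1', hC2', hC3', hC4', hC5', hC6']
    have f3 : 0 < ((d₀ : ℝ) + d₃ - e - d₁) := by linarith only [h0e', he1', h12', h23', hC1', hC2', hC3', hC4', hC5', hC6']
    have f4 : 0 < ((e : ℝ) - d₀) := by linarith only [h0e', he1', h12', h23', hC1', hC2', hC3', hC4', hC5', hC6']
    have f5 : 0 < ((d₃ : ℝ) - d₁) := by linarith only [h0e', he1', h12', h23', hC1', hC2', hC3', hC4', hC5', hC6']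
    have f6 : 0 < ((d₃ : ℝ) - d₂) := by linarith only [h0e', he1', h12', h23', hC1', hC2', hC3', hC4', hC5', hC6']
    have f7 : 0 < ((d₁ : ℝ) - d₀) := by linarith only [h0e', he1', h12', h23', hC1', hC2', hC3', hC4', hC5', hC6']
    have f8 : 0 < ((d₂ : ℝ) - d₀) := by linarith only [h0e', he1', h12', h23', hC1', hC2', hC3', hC4', hC5', hC6']
    exact mul_pos (mul_pos (mul_pos (mul_pos (mul_pos (mul_pos (mul_pos f1 f2) f3) f4) f5) f6) f7) f8
  have hPCC2 : 0 < (((d₁ : ℝ) + d₂ - 2 * e) * ((d₁ : ℝ) + d₂ - e - d₀) * ((d₂ : ℝ) - e) * ((e : ℝ) + d₃ - d₁ - d₂) * ((d₂ : ℝ) - d₀) * ((d₁ : ℝ) - d₀) * ((d₃ : ℝ) - d₂) * ((d₃ : ℝ) - d₁)) := by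
    have f1 : 0 < ((d₁ : ℝ) + d₂ - 2 * e) := by linarith only [h0e', he1', h12', h23', hC1', hC2', hC3', hC4', hC5', hC6']
    have f2 : 0 < ((d₁ : ℝ) + d₂ - e - d₀) := by linarith only [h0e', he1', h12', h23', hC1', hC2', hC3', hC4', hC5', hC6']
    have f3 : 0 < ((d₂ : ℝ) - e) := by linarith only [h0e', he1', h12', h23', hC1', hC2', hC3', hC4', hC5', hC6']
    have f4 : 0 < ((e : ℝ) + d₃ - d₁ - d₂) := by linarith only [h0e', he1', h12', h23', hC1', hC2', hC3', hC4', hC5', hC6']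
    have f5 : 0 < ((d₂ : ℝ) - d₀) := by linarith only [h0e', he1', h12', h23', hC1', hC2', hC3', hC4', hC5', hC6']
    have f6 : 0 < ((d₁ : ℝ) - d₀) := by linarith only [h0e', he1', h12', h23', hC1', hC2', hC3', hC4', hC5', hC6']
    have f7 : 0 < ((d₃ : ℝ) - d₂) := by linarith only [h0e', he1', h12', h23', hC1', hC2', hC3', hC4', hC5', hC6']
    have f8 : 0 < ((d₃ : ℝ) - d₁) := by linarith only [h0e', he1', h12', h23', hC1', hC2', hC3', hC4', hC5', hC6']
    exact mul_pos (mul_pos (mul_pos (mul_pos (mul_pos (mul_pos (mul_pos f1 f2) f3) f4) f5) f6) f7) f8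
  have hL1 : 0 ≤ (w₀ * w₂ * D02 * (((d₂ : ℝ) - e) * ((e : ℝ) - d₀) * ((e : ℝ) + d₃ - d₀ - d₂) * ((d₂ : ℝ) - d₁) * ((d₃ : ℝ) - d₂) * ((d₁ : ℝ) - d₀) * ((d₁ : ℝ) + d₃ - d₀ - d₂) * ((d₃ : ℝ) - d₀))) ^ (d₀ + d₂ - 2 * e + (e + d₁ - (d₀ + d₂))) * ((((e + d₁ - (d₀ + d₂) : ℕ) : ℝ)) ^ (e + d₁ - (d₀ + d₂)) * (((d₀ + d₂ - 2 * e : ℕ) : ℝ)) ^ (d₀ + d₂ - 2 * e)) :=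
    mul_nonneg (pow_nonneg (mul_nonneg (mul_nonneg (mul_nonneg hw₀.le hw₂.le) hD02.le) hPBN02.le) _) (mul_nonneg (pow_nonneg (Nat.cast_nonneg _) _) (pow_nonneg (Nat.cast_nonneg _) _))
  have hR1 : 0 ≤ (((d₀ + d₂ - 2 * e + (e + d₁ - (d₀ + d₂)) : ℕ) : ℝ)) ^ (d₀ + d₂ - 2 * e + (e + d₁ - (d₀ + d₂))) * (((-dJ) * (((e : ℝ) - d₀) * ((d₂ : ℝ) - e) * ((d₃ : ℝ) - e) * ((2 : ℝ) * e - d₀ - d₁) * ((d₀ : ℝ) + d₃ - 2 * e) * ((d₁ : ℝ) + d₂ - 2 * e) * ((d₁ : ℝ) + d₃ - 2 * e) * ((d₂ : ℝ) + d₃ - 2 * e))) ^ (e + d₁ - (d₀ + d₂)) * (w₁ * (-m₁) * (((d₁ : ℝ) - d₀) * ((d₂ : ℝ) - d₁) * ((d₃ : ℝ) - d₁) * ((e : ℝ) - d₀) * ((d₀ : ℝ) + d₃ - e - d₁) * ((d₂ : ℝ) - e) * ((d₃ : ℝ) - e) * ((d₂ : ℝ) + d₃ - e - d₁))) ^ (d₀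 + d₂ - 2 * e)) :=
    mul_nonneg (pow_nonneg (Nat.cast_nonneg _) _) (mul_nonneg (pow_nonneg (mul_nonneg (neg_nonneg.mpr hdJ.le) hPAN02.le) _) (pow_nonneg (mul_nonneg (mul_nonneg hw₁.le (neg_nonneg.mpr hm₁.le)) hPCN02.le) _))
  have hL2 : 0 ≤ (w₀ * w₃ * D03 * (((d₀ : ℝ) + d₃ - 2 * e) * ((d₃ : ℝ) - e) * ((e : ℝ) - d₀) * ((d₃ : ℝ) - d₁) * ((d₃ : ℝ) - d₂) * ((d₁ : ℝ) + d₂ - d₀ - d₃) * ((d₁ : ℝ) - d₀) * ((d₂ : ℝ) - d₀))) ^ (d₀ + d₃ - (e + d₁) + (e + d₂ - (d₀ + d₃))) * ((((e + d₂ - (d₀ + d₃) : ℕ) : ℝ)) ^ (e + d₂ - (d₀ + d₃)) * (((d₀ + d₃ - (e + d₁) : ℕ) : ℝ)) ^ (d₀ + d₃ - (e + d₁))) :=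
    mul_nonneg (pow_nonneg (mul_nonneg (mul_nonneg (mul_nonneg hw₀.le hw₃.le) hD03.le) hPBN03.le) _) (mul_nonneg (pow_nonneg (Nat.cast_nonneg _) _) (pow_nonneg (Nat.cast_nonneg _) _))
  have hR2 : 0 ≤ (((d₀ + d₃ - (e + d₁) + (e + d₂ - (d₀ + d₃)) : ℕ) : ℝ)) ^ (d₀ + d₃ - (e + d₁) + (e + d₂ - (d₀ + d₃))) * ((w₁ * (-m₁) * (((d₁ : ℝ) - e) * ((d₁ : ℝ) - d₀) * ((d₃ : ℝ) - d₁) * ((e : ℝ) - d₀) * ((e : ℝ) + d₁ - d₀ - d₂) * ((d₂ : ℝ) - e) * ((d₃ : ℝ) - e) * ((d₂ : ℝ) + d₃ - e - d₁))) ^ (e + d₂ - (d₀ + d₃)) * (w₂ * (-m₂) * (((d₂ : ℝ) - e) * ((d₂ : ℝ) - d₀) * ((d₃ : ℝ) - d₂) * ((e : ℝ) + d₂ - d₀ - d₁) * ((e : ℝ) - d₀) * ((d₁ : ℝ) - e) * ((d₁ : ℝ) + d₃ - e - d₂) * ((d₃ : ℝ) - e))) ^ (d₀ + d₃ - (e +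 d₁))) :=
    mul_nonneg (pow_nonneg (Nat.cast_nonneg _) _) (mul_nonneg (pow_nonneg (mul_nonneg (mul_nonneg hw₁.le (neg_nonneg.mpr hm₁.le)) hPAN03.le) _) (pow_nonneg (mul_nonneg (mul_nonneg hw₂.le (neg_nonneg.mpr hm₂.le)) hPCN03.le) _))
  have hL3 : 0 ≤ (w₁ * (-m₁) * (((d₁ : ℝ) - e) * ((d₁ : ℝ) - d₀) * ((d₂ : ℝ) - d₁) * ((d₃ : ℝ) - d₁) * ((e : ℝ) - d₀) * ((d₂ : ℝ) - e) * ((d₃ : ℝ) - e) * ((d₂ : ℝ) + d₃ - e - d₁))) ^ ((e + d₁) - d₀ - d₂ + ((d₀ + d₃) - e - d₁)) * (((((d₀ + d₃) - e - d₁ : ℕ) : ℝ)) ^ ((d₀ + d₃) - e - d₁) * ((((e + d₁) - d₀ - d₂ : ℕ) : ℝ)) ^ ((e + d₁) - d₀ - d₂)) :=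
    mul_nonneg (pow_nonneg (mul_nonneg (mul_nonneg hw₁.le (neg_nonneg.mpr hm₁.le)) hPBC1.le) _) (mul_nonneg (pow_nonneg (Nat.cast_nonneg _) _) (pow_nonneg (Nat.cast_nonneg _) _))
  have hR3 : 0 ≤ ((((e + d₁) - d₀ - d₂ + ((d₀ + d₃) - e - d₁) : ℕ) : ℝ)) ^ ((e + d₁) - d₀ - d₂ + ((d₀ + d₃) - e - d₁)) * ((w₀ * w₂ * D02 * (((d₀ : ℝ) + d₂ - 2 * e) * ((d₂ : ℝ) - e) * ((e : ℝ) - d₀) * ((e : ℝ) + d₃ - d₀ - d₂) * ((d₂ : ℝ) - d₁) * ((d₁ : ℝ) - d₀) * ((d₁ : ℝ) + d₃ - d₀ - d₂) * ((d₃ : ℝ) - d₀))) ^ ((d₀ + d₃) - e - d₁) * (w₀ * w₃ * D03 * (((d₀ : ℝ) + d₃ - 2 * e) * ((d₃ : ℝ) - e) * ((e : ℝ) + d₂ - d₀ - d₃) * ((e : ℝ) - d₀) * ((d₃ : ℝ) - d₁) * ((d₁ : ℝ) + d₂ - d₀ - d₃) * ((d₁ : ℝ) - d₀) * ((d₂ :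 ℝ) - d₀))) ^ ((e + d₁) - d₀ - d₂)) :=
    mul_nonneg (pow_nonneg (Nat.cast_nonneg _) _) (mul_nonneg (pow_nonneg (mul_nonneg (mul_nonneg (mul_nonneg hw₀.le hw₂.le) hD02.le) hPAC1.le) _) (pow_nonneg (mul_nonneg (mul_nonneg (mul_nonneg hw₀.le hw₃.le) hD03.le) hPCC1.le) _))
  have hR4 : 0 ≤ ((((e + d₂) - d₀ - d₃ + (d₁ - e) : ℕ) : ℝ)) ^ ((e + d₂) - d₀ - d₃ + (d₁ - e)) * ((w₀ * w₃ * D03 * (((d₀ : ℝ) + d₃ - 2 * e) * ((d₃ : ℝ) - e) * ((d₀ : ℝ) + d₃ - e - d₁) * ((e : ℝ) - d₀) * ((d₃ : ℝ) - d₁) * ((d₃ : ℝ) - d₂) * ((d₁ : ℝ) - d₀) * ((d₂ : ℝ) - d₀))) ^ (d₁ - e) * (w₁ * w₂ * D12 * (((d₁ : ℝ) + d₂ - 2 * e) * ((d₁ : ℝ) + d₂ - e - d₀) * ((d₂ : ℝ) - e) * ((e : ℝ) + d₃ - d₁ - d₂) * ((d₂ : ℝ) - d₀) * ((d₁ : ℝ)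 - d₀) * ((d₃ : ℝ) - d₂) * ((d₃ : ℝ) - d₁))) ^ ((e + d₂) - d₀ - d₃)) :=
    mul_nonneg (pow_nonneg (Nat.cast_nonneg _) _) (mul_nonneg (pow_nonneg (mul_nonneg (mul_nonneg (mul_nonneg hw₀.le hw₃.le) hD03.le) hPAC2.le) _) (pow_nonneg (mul_nonneg (mul_nonneg (mul_nonneg hw₁.le hw₂.le) hD12.le) hPCC2.le) _))
  have key : ((w₀ * w₂ * D02 * (((d₂ : ℝ) - e) * ((e : ℝ) - d₀) * ((e : ℝ) + d₃ - d₀ - d₂) * ((d₂ : ℝ) - d₁) * ((d₃ : ℝ) - d₂) * ((d₁ : ℝ) - d₀) * ((d₁ : ℝ) + d₃ - d₀ - d₂) * ((d₃ : ℝ) - d₀))) ^ (d₀ + d₂ - 2 * e + (e + d₁ - (d₀ + d₂))) * ((((e + d₁ - (d₀ + d₂) : ℕ) : ℝ)) ^ (e + d₁ - (d₀ + d₂)) * (((d₀ + d₂ - 2 * e : ℕ) : ℝ)) ^ (d₀ + d₂ - 2 * e))) ^ ((d₀ + d₃ - (e + d₁)) * (e + d₂ - (d₀ + d₃))) * ((w₀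 * w₃ * D03 * (((d₀ : ℝ) + d₃ - 2 * e) * ((d₃ : ℝ) - e) * ((e : ℝ) - d₀) * ((d₃ : ℝ) - d₁) * ((d₃ : ℝ) - d₂) * ((d₁ : ℝ) + d₂ - d₀ - d₃) * ((d₁ : ℝ) - d₀) * ((d₂ : ℝ) - d₀))) ^ (d₀ + d₃ - (e + d₁) + (e + d₂ - (d₀ + d₃))) * ((((e + d₂ - (d₀ + d₃) : ℕ) : ℝ)) ^ (e + d₂ - (d₀ + d₃)) * (((d₀ + d₃ - (e + d₁) : ℕ) : ℝ)) ^ (d₀ + d₃ - (e + d₁)))) ^ ((d₁ - e) * (e + d₁ - (d₀ + d₂))) * ((w₁ * (-m₁) * (((d₁ : ℝ) - e) * ((d₁ : ℝ) - d₀) * ((d₂ : ℝ) - d₁) * ((d₃ : ℝ) - d₁) * ((e : ℝ) - d₀) * ((d₂ : ℝ) - e) * ((d₃ : ℝ) - e) * ((d₂ : ℝ) + d₃ - e - d₁))) ^ ((e + d₁) - d₀ - d₂ + ((d₀ + d₃) - e - d₁)) * (((((d₀ + d₃) - e - d₁ : ℕ) : ℝ)) ^ ((d₀ + d₃) - e -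 d₁) * ((((e + d₁) - d₀ - d₂ : ℕ) : ℝ)) ^ ((e + d₁) - d₀ - d₂))) ^ ((d₁ - e) * (e + d₂ - (d₀ + d₃))) * ((w₂ * (-m₂) * (((d₂ : ℝ) - e) * ((d₂ : ℝ) - d₀) * ((d₂ : ℝ) - d₁) * ((d₃ : ℝ) - d₂) * ((e : ℝ) + d₂ - d₀ - d₁) * ((e : ℝ) - d₀) * ((d₁ : ℝ) + d₃ - e - d₂) * ((d₃ : ℝ) - e))) ^ ((e + d₂) - d₀ - d₃ + (d₁ - e)) * ((((d₁ - e : ℕ) : ℝ)) ^ (d₁ - e) * ((((e + d₂) - d₀ - d₃ : ℕ) : ℝ)) ^ ((e + d₂) - d₀ - d₃))) ^ ((e + d₁ - (d₀ + d₂)) * (d₀ + d₃ - (e + d₁)))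
      < ((((d₀ + d₂ - 2 * e + (e + d₁ - (d₀ + d₂)) : ℕ) : ℝ)) ^ (d₀ + d₂ - 2 * e + (e + d₁ - (d₀ + d₂))) * (((-dJ) * (((e : ℝ) - d₀) * ((d₂ : ℝ) - e) * ((d₃ : ℝ) - e) * ((2 : ℝ) * e - d₀ - d₁) * ((d₀ : ℝ) + d₃ - 2 * e) * ((d₁ : ℝ) + d₂ - 2 * e) * ((d₁ : ℝ) + d₃ - 2 * e) * ((d₂ : ℝ) + d₃ - 2 * e))) ^ (e + d₁ - (d₀ + d₂)) * (w₁ * (-m₁) * (((d₁ : ℝ) - d₀) * ((d₂ : ℝ) - d₁) * ((d₃ : ℝ) - d₁) * ((e : ℝ) - d₀) * ((d₀ : ℝ) + d₃ - e - d₁) * ((d₂ : ℝ) - e) * ((d₃ : ℝ) - e) * ((d₂ : ℝ) + d₃ - e - d₁))) ^ (d₀ + d₂ - 2 * e))) ^ ((d₀ + d₃ - (e + d₁)) * (e + d₂ - (d₀ + d₃))) * ((((d₀ + d₃ - (e + d₁) + (e + d₂ - (d₀ + d₃)) : ℕ) : ℝ)) ^ (d₀ + d₃ - (e + d₁) + (e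 + d₂ - (d₀ + d₃))) * ((w₁ * (-m₁) * (((d₁ : ℝ) - e) * ((d₁ : ℝ) - d₀) * ((d₃ : ℝ) - d₁) * ((e : ℝ) - d₀) * ((e : ℝ) + d₁ - d₀ - d₂) * ((d₂ : ℝ) - e) * ((d₃ : ℝ) - e) * ((d₂ : ℝ) + d₃ - e - d₁))) ^ (e + d₂ - (d₀ + d₃)) * (w₂ * (-m₂) * (((d₂ : ℝ) - e) * ((d₂ : ℝ) - d₀) * ((d₃ : ℝ) - d₂) * ((e : ℝ) + d₂ - d₀ - d₁) * ((e : ℝ) - d₀) * ((d₁ : ℝ) - e) * ((d₁ : ℝ) + d₃ - e - d₂) * ((d₃ : ℝ) - e))) ^ (d₀ + d₃ - (e + d₁)))) ^ ((d₁ - e) * (e + d₁ - (d₀ + d₂))) * (((((e + d₁) - d₀ - d₂ + ((d₀ + d₃) - e - d₁) : ℕ) : ℝ)) ^ ((e + d₁) - d₀ - d₂ + ((d₀ + d₃) - e - d₁)) * ((w₀ * w₂ * D02 * (((d₀ : ℝ) + d₂ - 2 * e) * ((d₂ : ℝ) - e) * ((e : ℝ) - d₀) * ((e : ℝ) + d₃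 - d₀ - d₂) * ((d₂ : ℝ) - d₁) * ((d₁ : ℝ) - d₀) * ((d₁ : ℝ) + d₃ - d₀ - d₂) * ((d₃ : ℝ) - d₀))) ^ ((d₀ + d₃) - e - d₁) * (w₀ * w₃ * D03 * (((d₀ : ℝ) + d₃ - 2 * e) * ((d₃ : ℝ) - e) * ((e : ℝ) + d₂ - d₀ - d₃) * ((e : ℝ) - d₀) * ((d₃ : ℝ) - d₁) * ((d₁ : ℝ) + d₂ - d₀ - d₃) * ((d₁ : ℝ) - d₀) * ((d₂ : ℝ) - d₀))) ^ ((e + d₁) - d₀ - d₂))) ^ ((d₁ - e) * (e + d₂ - (d₀ + d₃))) * (((((e + d₂) - d₀ - d₃ + (d₁ - e) : ℕ) : ℝ)) ^ ((e + d₂) - d₀ - d₃ + (d₁ - e)) * ((w₀ * w₃ * D03 * (((d₀ : ℝ) + d₃ - 2 * e) * ((d₃ : ℝ) - e) * ((d₀ : ℝ) + d₃ - e - d₁) * ((e : ℝ) - d₀) * ((d₃ : ℝ) - d₁) * ((d₃ : ℝ) - d₂) * ((d₁ : ℝ) - d₀) * ((d₂ : ℝ) - d₀))) ^ (d₁ -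 e) * (w₁ * w₂ * D12 * (((d₁ : ℝ) + d₂ - 2 * e) * ((d₁ : ℝ) + d₂ - e - d₀) * ((d₂ : ℝ) - e) * ((e : ℝ) + d₃ - d₁ - d₂) * ((d₂ : ℝ) - d₀) * ((d₁ : ℝ) - d₀) * ((d₃ : ℝ) - d₂) * ((d₃ : ℝ) - d₁))) ^ ((e + d₂) - d₀ - d₃))) ^ ((e + d₁ - (d₀ + d₂)) * (d₀ + d₃ - (e + d₁))) := by
    have Wpos : 0 < w₀ ^ (((d₀ + d₃ - (e + d₁)) * (e + d₂ - (d₀ + d₃))) * ((d₀ + d₂ - 2 * e) + (e + d₁ - (d₀ + d₂))) + ((d₁ - e) * (e + d₁ - (d₀ + d₂))) * ((d₀ + d₂ - 2 * e) + (e + d₂ - (d₀ + d₃)) + (e + d₃ - (d₁ + d₂)))) * w₁ ^ (((d₁ - e) * (e + d₂ - (d₀ + d₃))) * ((d₀ + d₂ - 2 * e) + (e + d₁ - (d₀ + d₂)) + (e + d₃ - (d₁ + d₂)))) * w₂ ^ (((d₀ + d₃ - (e + d₁)) * (e + d₂ - (d₀ + d₃))) * ((d₀ + d₂ - 2 * e)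 + (e + d₁ - (d₀ + d₂))) + ((e + d₁ - (d₀ + d₂)) * (d₀ + d₃ - (e + d₁))) * ((d₀ + d₂ - 2 * e) + (e + d₁ - (d₀ + d₂)) + (e + d₂ - (d₀ + d₃)))) * w₃ ^ (((d₁ - e) * (e + d₁ - (d₀ + d₂))) * ((d₀ + d₂ - 2 * e) + (e + d₂ - (d₀ + d₃)) + (e + d₃ - (d₁ + d₂)))) := by positivity
    have h := mul_lt_mul_of_pos_left hcomb Wpos
    rw [show (e + d₁) - d₀ - d₂ + ((d₀ + d₃) - e - d₁) = (d₀ + d₂ - 2 * e) + (e + d₁ - (d₀ + d₂)) + (e + d₃ - (d₁ + d₂)) from by omega] at h ⊢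
    rw [show d₀ + d₃ - (e + d₁) + (e + d₂ - (d₀ + d₃)) = (d₀ + d₂ - 2 * e) + (e + d₂ - (d₀ + d₃)) + (e + d₃ - (d₁ + d₂)) from by omega] at h ⊢
    rw [show d₀ + d₂ - 2 * e + (e + d₁ - (d₀ + d₂)) = (d₀ + d₂ - 2 * e) + (e + d₁ - (d₀ + d₂)) from by omega] at h ⊢
    rw [show (e + d₂) - d₀ - d₃ + (d₁ - e) = (d₀ + d₂ - 2 * e) + (e + d₁ - (d₀ + d₂)) + (e + d₂ - (d₀ + d₃)) from by omega] at h ⊢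
    rw [show (e + d₂) - d₀ - d₃ = (e + d₂ - (d₀ + d₃)) from by omega] at h ⊢
    rw [show (e + d₁) - d₀ - d₂ = (e + d₁ - (d₀ + d₂)) from by omega] at h ⊢
    rw [show d₀ + d₃ - (e + d₁) = (d₀ + d₂ - 2 * e) + (e + d₃ - (d₁ + d₂)) from by omega] at h ⊢
    rw [show (d₀ + d₃) - e - d₁ = (d₀ + d₂ - 2 * e) + (e + d₃ - (d₁ + d₂)) from by omega] at h ⊢
    rw [show d₁ - e = (d₀ + d₂ - 2 * e) + (e + d₁ - (d₀ + d₂)) from by omega] at h ⊢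
    generalize (((d₂ : ℝ) - e) * ((e : ℝ) - d₀) * ((e : ℝ) + d₃ - d₀ - d₂) * ((d₂ : ℝ) - d₁) * ((d₃ : ℝ) - d₂) * ((d₁ : ℝ) - d₀) * ((d₁ : ℝ) + d₃ - d₀ - d₂) * ((d₃ : ℝ) - d₀)) = PBN02 at h ⊢
    generalize (((e : ℝ) - d₀) * ((d₂ : ℝ) - e) * ((d₃ : ℝ) - e) * ((2 : ℝ) * e - d₀ - d₁) * ((d₀ : ℝ) + d₃ - 2 * e) * ((d₁ : ℝ) + d₂ - 2 * e) * ((d₁ : ℝ) + d₃ - 2 * e) * ((d₂ : ℝ) + d₃ - 2 * e)) = PAN02 at h ⊢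
    generalize (((d₁ : ℝ) - d₀) * ((d₂ : ℝ) - d₁) * ((d₃ : ℝ) - d₁) * ((e : ℝ) - d₀) * ((d₀ : ℝ) + d₃ - e - d₁) * ((d₂ : ℝ) - e) * ((d₃ : ℝ) - e) * ((d₂ : ℝ) + d₃ - e - d₁)) = PCN02 at h ⊢
    generalize (((d₀ : ℝ) + d₃ - 2 * e) * ((d₃ : ℝ) - e) * ((e : ℝ) - d₀) * ((d₃ : ℝ) - d₁) * ((d₃ : ℝ) - d₂) * ((d₁ : ℝ) + d₂ - d₀ - d₃) * ((d₁ : ℝ) - d₀) * ((d₂ : ℝ) - d₀)) = PBN03 at h ⊢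
    generalize (((d₁ : ℝ) - e) * ((d₁ : ℝ) - d₀) * ((d₃ : ℝ) - d₁) * ((e : ℝ) - d₀) * ((e : ℝ) + d₁ - d₀ - d₂) * ((d₂ : ℝ) - e) * ((d₃ : ℝ) - e) * ((d₂ : ℝ) + d₃ - e - d₁)) = PAN03 at h ⊢
    generalize (((d₂ : ℝ) - e) * ((d₂ : ℝ) - d₀) * ((d₃ : ℝ) - d₂) * ((e : ℝ) + d₂ - d₀ - d₁) * ((e : ℝ) - d₀) * ((d₁ : ℝ) - e) * ((d₁ : ℝ) + d₃ - e - d₂) * ((d₃ : ℝ) - e)) = PCN03 at h ⊢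
    generalize (((d₁ : ℝ) - e) * ((d₁ : ℝ) - d₀) * ((d₂ : ℝ) - d₁) * ((d₃ : ℝ) - d₁) * ((e : ℝ) - d₀) * ((d₂ : ℝ) - e) * ((d₃ : ℝ) - e) * ((d₂ : ℝ) + d₃ - e - d₁)) = PBC1 at h ⊢
    generalize (((d₀ : ℝ) + d₂ - 2 * e) * ((d₂ : ℝ) - e) * ((e : ℝ) - d₀) * ((e : ℝ) + d₃ - d₀ - d₂) * ((d₂ : ℝ) - d₁) * ((d₁ : ℝ) - d₀) * ((d₁ : ℝ) + d₃ - d₀ - d₂) * ((d₃ : ℝ) - d₀)) = PAC1 at h ⊢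
    generalize (((d₀ : ℝ) + d₃ - 2 * e) * ((d₃ : ℝ) - e) * ((e : ℝ) + d₂ - d₀ - d₃) * ((e : ℝ) - d₀) * ((d₃ : ℝ) - d₁) * ((d₁ : ℝ) + d₂ - d₀ - d₃) * ((d₁ : ℝ) - d₀) * ((d₂ : ℝ) - d₀)) = PCC1 at h ⊢
    generalize (((d₂ : ℝ) - e) * ((d₂ : ℝ) - d₀) * ((d₂ : ℝ) - d₁) * ((d₃ : ℝ) - d₂) * ((e : ℝ) + d₂ - d₀ - d₁) * ((e : ℝ) - d₀) * ((d₁ : ℝ) + d₃ - e - d₂) * ((d₃ : ℝ) - e)) = PBC2 at h ⊢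
    generalize (((d₀ : ℝ) + d₃ - 2 * e) * ((d₃ : ℝ) - e) * ((d₀ : ℝ) + d₃ - e - d₁) * ((e : ℝ) - d₀) * ((d₃ : ℝ) - d₁) * ((d₃ : ℝ) - d₂) * ((d₁ : ℝ) - d₀) * ((d₂ : ℝ) - d₀)) = PAC2 at h ⊢
    generalize (((d₁ : ℝ) + d₂ - 2 * e) * ((d₁ : ℝ) + d₂ - e - d₀) * ((d₂ : ℝ) - e) * ((e : ℝ) + d₃ - d₁ - d₂) * ((d₂ : ℝ) - d₀) * ((d₁ : ℝ) - d₀) * ((d₃ : ℝ) - d₂) * ((d₃ : ℝ) - d₁)) = PCC2 at h ⊢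
    generalize -m₁ = n₁ at h ⊢
    generalize -m₂ = n₂ at h ⊢
    generalize -dJ = nJ at h ⊢
    generalize d₀ + d₂ - 2 * e = g₃ at h ⊢
    generalize e + d₁ - (d₀ + d₂) = g₄ at h ⊢
    generalize e + d₂ - (d₀ + d₃) = g₆ at h ⊢
    generalize e + d₃ - (d₁ + d₂) = g₈ at h ⊢
    generalize ((g₃ + g₄ + g₆ : ℕ) : ℝ) = c_g₃_g₄_g₆ at h ⊢
    generalize ((g₃ + g₆ + g₈ : ℕ) : ℝ) = c_g₃_g₆_g₈ at h ⊢
    generalize ((g₃ + g₄ + g₈ : ℕ) : ℝ) = c_g₃_g₄_g₈ at h ⊢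
    generalize ((g₃ + g₄ : ℕ) : ℝ) = c_g₃_g₄ at h ⊢
    generalize ((g₃ + g₈ : ℕ) : ℝ) = c_g₃_g₈ at h ⊢
    generalize ((g₄ : ℕ) : ℝ) = c_g₄ at h ⊢
    generalize ((g₃ : ℕ) : ℝ) = c_g₃ at h ⊢
    generalize ((g₆ : ℕ) : ℝ) = c_g₆ at h ⊢
    convert h using 1 <;> first | rfl | ring
  exact elevenNomial_chamberC_C2_le_eight e d₀ d₁ d₂ d₃ h0e he1 h12 h23 hC4 hC5 hC6 dJ m₀ m₁ m₂ m₃ w₀ w₁ w₂ w₃ D01 D02 D03 D12 D13 D23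
    hw₀ hw₁ hw₂ hw₃ hD03 hD12
    (circuitRay_transfer_four (m₁ := (d₀ + d₃ - (e + d₁)) * (e + d₂ - (d₀ + d₃))) (m₂ := (d₁ - e) * (e + d₁ - (d₀ + d₂))) (m₃ := (d₁ - e) * (e + d₂ - (d₀ + d₃))) (m₄ := (e + d₁ - (d₀ + d₂)) * (d₀ + d₃ - (e + d₁))) hL1 hL2 hL3 hR1 hR2 hR3 hR4 h1 h2 h3 key)

/-- **Rank-one `(2,4)₁`, split 1/3, chamber (C): `Z₊ ≤ 8` under the weight-free circuit ray «N02 ∨ N03 ∨ C1 ∨ C2»** (matrix form; `J` any real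
`2 × 2` matrix). [this file] -/
theorem oneThree_rankOne_posRoots_le_eight_of_N02N03C1C2 (e d₀ d₁ d₂ d₃ : ℕ) (h0e : d₀ < e) (he1 : e < d₁) (h12 : d₁ < d₂)
    (h23 : d₂ < d₃) (hC1 : d₀ + d₁ < 2 * e) (hC2 : 2 * e < d₀ + d₂) (hC3 : d₀ + d₂ < e + d₁) (hC4 : e + d₁ < d₀ + d₃)
    (hC5 : d₀ + d₃ < e + d₂) (hC6 : d₁ + d₂ < e + d₃)
    (J : Matrix (Fin 2) (Fin 2) ℝ) (v₀ v₁ v₂ v₃ : Fin 2 → ℝ) (w₀ w₁ w₂ w₃ : ℝ) (hw₀ : 0 < w₀) (hw₁ : 0 < w₁) (hw₂ : 0 < w₂) (hw₃ : 0 < w₃) (hm₁ : (J 0 0 * v₁ 1 ^ 2 + J 1 1 * v₁ 0 ^ 2 - (J 0 1 + J 1 0) * (v₁ 0 * v₁ 1)) < 0) (hm₂ : (J 0 0 * v₂ 1 ^ 2 + J 1 1 * v₂ 0 ^ 2 - (J 0 1 + J 1 0) * (v₂ 0 * v₂ 1)) < 0) (hdJ : J.det < 0) (hD02 : 0 < ((v₀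 0 * v₂ 1 - v₀ 1 * v₂ 0) ^ 2)) (hD03 : 0 < ((v₀ 0 * v₃ 1 - v₀ 1 * v₃ 0) ^ 2)) (hD12 : 0 < ((v₁ 0 * v₂ 1 - v₁ 1 * v₂ 0) ^ 2))
    (hcomb : ((((v₀ 0 * v₂ 1 - v₀ 1 * v₂ 0) ^ 2) * (((d₂ : ℝ) - e) * ((e : ℝ) - d₀) * ((e : ℝ) + d₃ - d₀ - d₂) * ((d₂ : ℝ) - d₁) * ((d₃ : ℝ) - d₂) * ((d₁ : ℝ) - d₀) * ((d₁ : ℝ) + d₃ - d₀ - d₂) * ((d₃ : ℝ) - d₀))) ^ (d₀ + d₂ - 2 * e + (e + d₁ - (d₀ + d₂))) * ((((e + d₁ - (d₀ + d₂) : ℕ) : ℝ)) ^ (e + d₁ - (d₀ + d₂)) * (((d₀ + d₂ - 2 * e : ℕ) : ℝ)) ^ (d₀ + d₂ - 2 * e))) ^ ((d₀ + d₃ - (e + d₁)) * (e + d₂ - (d₀ + d₃))) * ((((v₀ 0 * v₃ 1 - v₀ 1 * v₃ 0) ^ 2) * (((d₀ : ℝ) + d₃ - 2 * e) * ((d₃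 : ℝ) - e) * ((e : ℝ) - d₀) * ((d₃ : ℝ) - d₁) * ((d₃ : ℝ) - d₂) * ((d₁ : ℝ) + d₂ - d₀ - d₃) * ((d₁ : ℝ) - d₀) * ((d₂ : ℝ) - d₀))) ^ (d₀ + d₃ - (e + d₁) + (e + d₂ - (d₀ + d₃))) * ((((e + d₂ - (d₀ + d₃) : ℕ) : ℝ)) ^ (e + d₂ - (d₀ + d₃)) * (((d₀ + d₃ - (e + d₁) : ℕ) : ℝ)) ^ (d₀ + d₃ - (e + d₁)))) ^ ((d₁ - e) * (e + d₁ - (d₀ + d₂))) * (((-(J 0 0 * v₁ 1 ^ 2 + J 1 1 * v₁ 0 ^ 2 - (J 0 1 + J 1 0) * (v₁ 0 * v₁ 1))) * (((d₁ : ℝ) - e) * ((d₁ : ℝ) - d₀) * ((d₂ : ℝ) - d₁) * ((d₃ : ℝ) - d₁) * ((e : ℝ) - d₀) * ((d₂ : ℝ) - e) * ((d₃ : ℝ) - e) * ((d₂ : ℝ) + d₃ - e - d₁))) ^ ((e + d₁) - d₀ - d₂ + ((d₀ + d₃) - e - d₁)) * (((((d₀ + d₃) - e - d₁ : ℕ)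 : ℝ)) ^ ((d₀ + d₃) - e - d₁) * ((((e + d₁) - d₀ - d₂ : ℕ) : ℝ)) ^ ((e + d₁) - d₀ - d₂))) ^ ((d₁ - e) * (e + d₂ - (d₀ + d₃))) * (((-(J 0 0 * v₂ 1 ^ 2 + J 1 1 * v₂ 0 ^ 2 - (J 0 1 + J 1 0) * (v₂ 0 * v₂ 1))) * (((d₂ : ℝ) - e) * ((d₂ : ℝ) - d₀) * ((d₂ : ℝ) - d₁) * ((d₃ : ℝ) - d₂) * ((e : ℝ) + d₂ - d₀ - d₁) * ((e : ℝ) - d₀) * ((d₁ : ℝ) + d₃ - e - d₂) * ((d₃ : ℝ) - e))) ^ ((e + d₂) - d₀ - d₃ + (d₁ - e)) * ((((d₁ - e : ℕ) : ℝ)) ^ (d₁ - e) * ((((e + d₂) - d₀ - d₃ : ℕ) : ℝ)) ^ ((e + d₂) - d₀ - d₃))) ^ ((e + d₁ - (d₀ + d₂)) * (d₀ + d₃ - (e + d₁)))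
      < ((((d₀ + d₂ - 2 * e + (e + d₁ - (d₀ + d₂)) : ℕ) : ℝ)) ^ (d₀ + d₂ - 2 * e + (e + d₁ - (d₀ + d₂))) * (((-J.det) * (((e : ℝ) - d₀) * ((d₂ : ℝ) - e) * ((d₃ : ℝ) - e) * ((2 : ℝ) * e - d₀ - d₁) * ((d₀ : ℝ) + d₃ - 2 * e) * ((d₁ : ℝ) + d₂ - 2 * e) * ((d₁ : ℝ) + d₃ - 2 * e) * ((d₂ : ℝ) + d₃ - 2 * e))) ^ (e + d₁ - (d₀ + d₂)) * ((-(J 0 0 * v₁ 1 ^ 2 + J 1 1 * v₁ 0 ^ 2 - (J 0 1 + J 1 0) * (v₁ 0 * v₁ 1))) * (((d₁ : ℝ) - d₀) * ((d₂ : ℝ) - d₁) * ((d₃ : ℝ) - d₁) * ((e : ℝ) - d₀) * ((d₀ : ℝ) + d₃ - e - d₁) * ((d₂ : ℝ) - e) * ((d₃ : ℝ) - e) * ((d₂ : ℝ) + d₃ - e - d₁))) ^ (d₀ + d₂ - 2 * e))) ^ ((d₀ + d₃ - (e + d₁)) * (e + d₂ - (d₀ + d₃))) * ((((d₀ + d₃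 - (e + d₁) + (e + d₂ - (d₀ + d₃)) : ℕ) : ℝ)) ^ (d₀ + d₃ - (e + d₁) + (e + d₂ - (d₀ + d₃))) * (((-(J 0 0 * v₁ 1 ^ 2 + J 1 1 * v₁ 0 ^ 2 - (J 0 1 + J 1 0) * (v₁ 0 * v₁ 1))) * (((d₁ : ℝ) - e) * ((d₁ : ℝ) - d₀) * ((d₃ : ℝ) - d₁) * ((e : ℝ) - d₀) * ((e : ℝ) + d₁ - d₀ - d₂) * ((d₂ : ℝ) - e) * ((d₃ : ℝ) - e) * ((d₂ : ℝ) + d₃ - e - d₁))) ^ (e + d₂ - (d₀ + d₃)) * ((-(J 0 0 * v₂ 1 ^ 2 + J 1 1 * v₂ 0 ^ 2 - (J 0 1 + J 1 0) * (v₂ 0 * v₂ 1))) * (((d₂ : ℝ) - e) * ((d₂ : ℝ) - d₀) * ((d₃ : ℝ) - d₂) * ((e : ℝ) + d₂ - d₀ - d₁) * ((e : ℝ) - d₀) * ((d₁ : ℝ) - e) * ((d₁ : ℝ) + d₃ - e - d₂) * ((d₃ : ℝ) - e))) ^ (d₀ + d₃ - (e + d₁)))) ^ ((d₁ - e) * (e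 + d₁ - (d₀ + d₂))) * (((((e + d₁) - d₀ - d₂ + ((d₀ + d₃) - e - d₁) : ℕ) : ℝ)) ^ ((e + d₁) - d₀ - d₂ + ((d₀ + d₃) - e - d₁)) * ((((v₀ 0 * v₂ 1 - v₀ 1 * v₂ 0) ^ 2) * (((d₀ : ℝ) + d₂ - 2 * e) * ((d₂ : ℝ) - e) * ((e : ℝ) - d₀) * ((e : ℝ) + d₃ - d₀ - d₂) * ((d₂ : ℝ) - d₁) * ((d₁ : ℝ) - d₀) * ((d₁ : ℝ) + d₃ - d₀ - d₂) * ((d₃ : ℝ) - d₀))) ^ ((d₀ + d₃) - e - d₁) * (((v₀ 0 * v₃ 1 - v₀ 1 * v₃ 0) ^ 2) * (((d₀ : ℝ) + d₃ - 2 * e) * ((d₃ : ℝ) - e) * ((e : ℝ) + d₂ - d₀ - d₃) * ((e : ℝ) - d₀) * ((d₃ : ℝ) - d₁) * ((d₁ : ℝ) + d₂ - d₀ - d₃) * ((d₁ : ℝ) - d₀) * ((d₂ : ℝ) - d₀))) ^ ((e + d₁) - d₀ - d₂))) ^ ((d₁ - e) * (e + d₂ - (d₀ + d₃))) * (((((e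 + d₂) - d₀ - d₃ + (d₁ - e) : ℕ) : ℝ)) ^ ((e + d₂) - d₀ - d₃ + (d₁ - e)) * ((((v₀ 0 * v₃ 1 - v₀ 1 * v₃ 0) ^ 2) * (((d₀ : ℝ) + d₃ - 2 * e) * ((d₃ : ℝ) - e) * ((d₀ : ℝ) + d₃ - e - d₁) * ((e : ℝ) - d₀) * ((d₃ : ℝ) - d₁) * ((d₃ : ℝ) - d₂) * ((d₁ : ℝ) - d₀) * ((d₂ : ℝ) - d₀))) ^ (d₁ - e) * (((v₁ 0 * v₂ 1 - v₁ 1 * v₂ 0) ^ 2) * (((d₁ : ℝ) + d₂ - 2 * e) * ((d₁ : ℝ) + d₂ - e - d₀) * ((d₂ : ℝ) - e) * ((e : ℝ) + d₃ - d₁ - d₂) * ((d₂ : ℝ) - d₀) * ((d₁ : ℝ) - d₀) * ((d₃ : ℝ) - d₂) * ((d₃ : ℝ) - d₁))) ^ ((e + d₂) - d₀ - d₃))) ^ ((e + d₁ - (d₀ + d₂)) * (d₀ + d₃ - (e + d₁)))) :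
    ((Matrix.det (((X : ℝ[X]) ^ e) • J.map Polynomial.C
        + (Polynomial.C w₀ * X ^ d₀) • (vecMulVec v₀ v₀).map Polynomial.C
        + (Polynomial.C w₁ * X ^ d₁) • (vecMulVec v₁ v₁).map Polynomial.C
        + (Polynomial.C w₂ * X ^ d₂) • (vecMulVec v₂ v₂).map Polynomial.C
        + (Polynomial.C w₃ * X ^ d₃) • (vecMulVec v₃ v₃).map Polynomial.C)).roots.toFinset.filter (fun t => 0 < t)).card
      ≤ 8 := by
  rw [det_rankOne_four_sum]
  exact elevenNomial_chamberC_N02N03C1C2_le_eight e d₀ d₁ d₂ d₃ h0e he1 h12 h23 hC1 hC2 hC3 hC4 hC5 hC6 J.det _ _ _ _ w₀ w₁ w₂ w₃ _ _ _ _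
    _ _ hw₀ hw₁ hw₂ hw₃ hm₁ hm₂ hdJ hD02 hD03 hD12 hcomb

end Summit.ValiantsHypothesis.ValiantsHypothesis.Theorems.LacunarySymmetroidMatrixDescartes.Pivot.TwoDirections.BlockLaw
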